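import Literature.MathematicalPhysics.QuantumFieldTheory.Balaban1983to89.B15Prop1GaugeLetterGammaZeroPin
import Literature.MathematicalPhysics.QuantumFieldTheory.Balaban1983to89.B15Prop1MinimiserTowerAxialGaugeB

/-!
# `Balaban1983to89.B15Prop1GaugeLetterGammaZeroPinB` — [Balaban1988Convergent] = «[III]», (2.2) p. 255 («Γ₀ = Ω₁ᶜ»), (2.11)–(2.13) pp. 256–257, (2.16) p. 257;
# [Balaban1985Variational] = «[15]», (4) p. 278, (16)–(18) p. 280; [Balaban1984PropagatorsII] = «[II]», (2.3) p. 224 (the BOND-level determining datum);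
# [Balaban1989LargeFieldI] = «[IV]», (1.74) p. 192, Prop. 1 p. 194: THE GAUGE LETTER (σ) READ ON THE SCALE-`0` MEMBERS OF A BOND DETERMINING SET, AND THE LOCALISED
# LETTER THE TOWER-AXIAL GAUGE PRODUCES — print-datum ([II] (2.3)) edition of the lane's `B15Prop1GaugeLetterGammaZeroPin` §1∕§4 (the datum-typed declarations N12's
# junction of record v14ᴸ uses: `dist1_gaugeAct_holAtGauge_le_of_mem_nbhd`, `exists_gaugeLetterLoc_atRecord`) — class (γ)∕STRUCTURAL of dag-n12-c's census-by-declaration v2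
# (bus [DAGN12C-G35]∕[DAGN12C-G36], 2026-08-30)

Honest framing: statement-level skeleton of published theorems with citation tags; proofs where landed; nothing here is a claim about the
Yang–Mills mass gap.  Cell `pub-ymgap`, seat `pub-ymgap-dag-n12-c` (g36; LANE OWNER N12 = [B15], strategy s1); count-neutral helper of K1⁹ (`stmt-QuantumFields-27364`);
N12 NOT discharged; finite 𝕋⁴ at fixed ε; nothing continuum ∕ OS ∕ mass-gap ∕ Clay.

WHY A SEPARATE EDITION, AND WHAT CHANGES (the (E1)(iii-b) re-attachment, director-ym №338–№358; LOCATED-2 of the lane's census, made explicit here).  The parent's §4 splits the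
bonds of a neighbourhood `N` by ONE dichotomy: both end-points in `Ω₁(Z)` ⇒ the displayed interior letter `hL` ([15] (16)–(18) in the gauge `Ax_k(𝔅_k, U₀)`); an end-point off `Ω₁(Z)`
⇒ the pinned half (`Bj_zero`: every bond MEETING `Ω₁(Z)ᶜ` is a `Γ₀`-bond of the tree's site-level `𝐁_k(Z)`, a root pair, pinned to the datum).  Over print's [II] (2.3) BOND-level datum
`𝔅` (`B15DeterminingSetsB.lamBondsSeq (maxDomT M₁ Z) k`; `mem_lamBondsSeq_iff_zero`) the scale-`0` member at the block union `Ω₁(Z)` is the set of bonds with BOTH end-points off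
`Ω₁(Z)` (`B15Prop1GradientFromNearValueB.mem_lamDatumP_maxDomT_zero_of_not_mem₂`, displayed as the letter `h𝔅0`): a CROSSING bond (one end in `Ω₁(Z)`, one off) is a free variable of
(2.12), NOT pinned, and NOT a root pair (only its `Λ₀`-end is a root).  So the dichotomy of this edition is: an end-point IN `Ω₁(Z)` ⇒ the interior letter `hL`, now asked on the bonds
TOUCHING `Ω₁(Z)` (`b₋ ∈ Ω₁ ∨ b₊ ∈ Ω₁`); both end-points off ⇒ the pinned half of ✓`B15Prop1MinimiserTowerAxialGaugeB` through `h𝔅0`.  In print the crossing bonds are indeed interior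
business: for `b = ⟨x, y⟩`, `x ∈ Ω₁(Z)`, `y ∈ Λ₀`, `U₀^σ(b) = 𝒰_{U₀}(root x → x)·U₀(b)` is an open line between TWO roots (`root x`, `y`), controlled — like every two-root bond of [15]
(16)–(18) — by the corridor estimate through the constrained average of the OUTWARD connector `⟨B¹x, μ⟩ ∈ Λ₁` ([II] (2.3) keeps the outward connectors and drops the inward ones), i.e. by
the root-transporter letter of `B15Prop1GaugeLetterLocOfForestPackage[B]` on an extended site set.
RE-KEY NOTE for the junction's generator (dag-n12-d): both theorems lose `hk0` and gain `(𝔅 : BDetSet P) (h𝔅0)` after `hk`; `hF2`∕`hu` over `c ∈ 𝔅 j`; `hmin : IsMinimizerB …`;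
`hGN : ∀ b ∈ N, b₋ ∉ Ω₁ → b₊ ∉ Ω₁ → (crossing) → shadow ∈ 𝒞` (two premises instead of the `∨`); `hL : ∀ b, (b₋ ∈ Ω₁ ∨ b₊ ∈ Ω₁) → … ≤ Θ` (ONE disjunctive premise instead of two
conjunctive ones — the producer must now cover the crossing bonds); the conclusion's third conjunct is `∀ b ∈ N, … ≤ max ρn Θ` on ALL of `N` (the parent's `b ∈ inputs 𝐁_k(Z)` binder is
dropped — consumers write `hCin b hbN` for `hCin b hb hbN`).

CONTENTS (theorems only; no `def`, no `instance`, no `sorry`; namespace `…B15Prop1GaugeLetterGammaZeroPinB`).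
* §1ᴮ `gaugeAct_apply_eq_qsstarGIter0_of_rootLetter` (`U₀^σ = Q_k^{s*}Ṽ` on `b ∈ 𝔅 0`, for ANY `σ` with the scale-`0` root letter), ★ `gaugeAct_apply_eq_shadow_of_rootLetter`
  (`= Ṽ⟨B^k b₋, μ(b)⟩` on a block-crossing one) — any `GaugeGroup`, datum-intrinsic.
* §4ᴮ ★★ `dist1_gaugeAct_holAtGauge_le_of_mem_nbhd` (junction on `N`: pinned half on the both-ends-off bonds + interior letter on the bonds touching `Ω₁(Z)` ⟹ `≤ max ρ Θ` on `N`),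
  ★★★ `exists_gaugeLetterLoc_atRecord` — THE LOCALISED (σ) AT THE ENDPOINT'S OBJECTS over `𝔅`: `∃ σ, hu ∧ C1(max ρn Θ) ∧ (∀ b ∈ N, … ≤ max ρn Θ)`.
HONEST SCOPE: kernel bookkeeping of [III] (2.2)∕(2.11)∕(2.16) over [II] (2.3) around landed theorems; the interior estimate [15] (16)–(18) (`hL`, now on the bonds touching `Ω₁(Z)`), the
forest (F1)(F2), the minimiser and the geometry of `N` are HYPOTHESES; nothing of Bałaban's is asserted; count-neutral; N12 NOT discharged; the YM mass gap (Clay) is NOT proved by any of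
this — R4 closes only the conditional finite-𝕋⁴ rung `BalabanLadder.UV`.
-/

noncomputable section

open Set
open scoped Matrix.Norms.L2Operator

namespace Literature.MathematicalPhysics.QuantumFieldTheory.Balaban1983to89.B15Prop1GaugeLetterGammaZeroPinB

open T4Continuum B15DeterminingSets B15DeterminingSetsB GaugeField
open T4CubeChartGnomonic (SU2)
open B16Sect1Backgrounds (toMS)
open B14.Eq213DetSet (maxDomT)
open B14.Eq216Concrete (qsstarGIter0_eq)
open B14.Eq22Determines (blockIter)
open B15Prop1MinimiserTowerAxialGaugeB (toMS_holAtGauge_eq_one dist1_gaugeAct_holAtGauge_le_of_shadow)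
open Literature.MathematicalPhysics.QuantumFieldTheory.BalabanImbrieJaffe1984to88.BIJ85Eq453GaugeField (qsstarGIter0)

variable {P : Params}

/-! ## §1ᴮ  On the scale-`0` members of the datum a residually gauged minimiser IS the datum -/

section GammaZero

variable {G : Type*} [GaugeGroup G]

/-- **`U₀^σ = Q_k^{s*}Ṽ` ON THE SCALE-`0` MEMBERS OF A BOND DETERMINING SET, FOR ANY RESIDUAL GAUGE** (datum-intrinsic): the scale-`0` constraint is `M⁰(U₀) = U₀ = Q_k^{s*}Ṽ` on
`𝔅 0`, and the root letter [15] (4) at scale `0` makes `σ` trivial at both ends of a member; so the gauged minimiser reads the datum there verbatim.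
[cite: Balaban1988Convergent, (2.11)–(2.13) pp.256–257; Balaban1985Variational, (4) p.278; Balaban1984PropagatorsII, (2.3) p.224] -/
theorem gaugeAct_apply_eq_qsstarGIter0_of_rootLetter (av : ∀ j, Averaging P j G) (reg : Set (GaugeField P 0 G))
    {k : ℕ} (W : GaugeField P k G) (𝔅 : BDetSet P) {U₀ : GaugeField P 0 G}
    (hmin : IsMinimizerB av reg 𝔅 (avgFamily av (qsstarGIter0 k W)) U₀) {σ : GaugeTransf P 0 G}
    (hu : ∀ c ∈ 𝔅 0, toMS σ 0 c.src = 1 ∧ toMS σ 0 c.tgt = 1)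
    {b : PBond P 0} (hb : b ∈ 𝔅 0) :
    gaugeAct σ U₀ b = qsstarGIter0 k W b := by
  obtain ⟨hs, ht⟩ := hu b hb
  have hs' : σ b.src = 1 := hs
  have ht' : σ b.tgt = 1 := ht
  have h1 : U₀ b = qsstarGIter0 k W b := hmin.2.1 0 b hb
  rw [GaugeField.gaugeAct, hs', ht', one_mul, inv_one, mul_one, h1]

/-- ★ **ON A BLOCK-CROSSING SCALE-`0` MEMBER THE GAUGED MINIMISER IS THE SHADOW VALUE OF THE DATUM FIELD**: `U₀^σ(b) = Ṽ⟨B^k b₋, μ(b)⟩` ([III] (2.16) ∕ [IV] (1.3); `k ≤ m + K`).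
[cite: Balaban1988Convergent, (2.16) p.257; Balaban1985Variational, (4) p.278; Balaban1984PropagatorsII, (2.3) p.224] -/
theorem gaugeAct_apply_eq_shadow_of_rootLetter (av : ∀ j, Averaging P j G) (reg : Set (GaugeField P 0 G))
    {k : ℕ} (hk : k ≤ P.m + P.K) (W : GaugeField P k G) (𝔅 : BDetSet P) {U₀ : GaugeField P 0 G}
    (hmin : IsMinimizerB av reg 𝔅 (avgFamily av (qsstarGIter0 k W)) U₀) {σ : GaugeTransf P 0 G}
    (hu : ∀ c ∈ 𝔅 0, toMS σ 0 c.src = 1 ∧ toMS σ 0 c.tgt = 1)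
    {b : PBond P 0} (hb : b ∈ 𝔅 0) (hcross : blockIter k b.tgt ≠ blockIter k b.src) :
    gaugeAct σ U₀ b = W ⟨blockIter k b.src, b.dir⟩ := by
  rw [gaugeAct_apply_eq_qsstarGIter0_of_rootLetter av reg W 𝔅 hmin hu hb, qsstarGIter0_eq k hk W b, if_neg hcross]

end GammaZero

/-! ## §4ᴮ  What the tower-axial gauge gives over a bond datum: the letter with `Cin` localised to a neighbourhood whose both-ends-off shadows are normalised -/

section Loc

/-- ★★ **JUNCTION ON A NEIGHBOURHOOD — BOND-DATUM EDITION**: for the tower-axial gauge `σ(x) = 𝒰_{U₀}(path x)` of a rooted forest with the root letter (F2) at `𝔅`, a (2.12) minimiser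
`U₀` (`IsMinimizerB`) of the data generated by `Ṽ` on a bond datum `𝔅` whose scale-`0` member contains the bonds with both end-points off `Ω₁(Z)` (`h𝔅0`), a set `𝒞` of `k`-bonds on which `Ṽ`
is `ρ`-near `1` (`0 ≤ ρ`), a bond set `N` whose block-crossing bonds with BOTH end-points off `Ω₁(Z)` have their shadows in `𝒞` (geometry), and the DISPLAYED interior letter — [15] (16)–(18)
in the gauge `Ax_k(𝔅_k, U₀)`: `dist1 (U₀^σ b) ≤ Θ` on every bond TOUCHING `Ω₁(Z)` (an end-point in `Ω₁(Z)`; the crossing bonds included) — every bond of `N` has `dist1 (U₀^σ b) ≤ max ρ Θ`.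
[cite: Balaban1985Variational, (4) p.278, (16)–(18) p.280; Balaban1985RegularSpaces, (1.19) p.79; Balaban1988Convergent, (2.2) p.255, (2.16) p.257; Balaban1984PropagatorsII, (2.3) p.224] -/
theorem dist1_gaugeAct_holAtGauge_le_of_mem_nbhd (av : ∀ j, Averaging P j SU2) (reg : Set (GaugeField P 0 SU2)) (M₁ : ℕ) (Z : Set (Site P 0))
    {k : ℕ} (hk : k ≤ P.m + P.K) (𝔅 : BDetSet P)
    (h𝔅0 : ∀ b : PBond P 0, b.src ∉ maxDomT M₁ Z 1 → b.tgt ∉ maxDomT M₁ Z 1 → b ∈ 𝔅 0)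
    (path : Site P 0 → List (LStep P 0))
    (hF2 : ∀ j, j ≤ k → ∀ c ∈ 𝔅 j, path (embIter j c.src) = [] ∧ path (embIter j c.tgt) = [])
    (W : GaugeField P k SU2) {U₀ : GaugeField P 0 SU2} (hmin : IsMinimizerB av reg 𝔅 (avgFamily av (qsstarGIter0 k W)) U₀)
    {ρ Θ : ℝ} (hρ : 0 ≤ ρ) {𝒞 : Set (PBond P k)} (h𝒞 : ∀ c ∈ 𝒞, dist1 (W c) ≤ ρ) {N : Set (PBond P 0)}
    (hGN : ∀ b ∈ N, b.src ∉ maxDomT M₁ Z 1 → b.tgt ∉ maxDomT M₁ Z 1 → blockIter k b.tgt ≠ blockIter k b.src →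
      (⟨blockIter k b.src, b.dir⟩ : PBond P k) ∈ 𝒞)
    (hL : ∀ b : PBond P 0, (b.src ∈ maxDomT M₁ Z 1 ∨ b.tgt ∈ maxDomT M₁ Z 1) → dist1 (gaugeAct (fun x => holAt U₀ (path x)) U₀ b) ≤ Θ)
    {b : PBond P 0} (hb : b ∈ N) :
    dist1 (gaugeAct (fun x => holAt U₀ (path x)) U₀ b) ≤ max ρ Θ := by
  by_cases h : b.src ∈ maxDomT M₁ Z 1 ∨ b.tgt ∈ maxDomT M₁ Z 1
  · exact (hL b h).trans (le_max_right _ _)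
  · obtain ⟨hbs, hbt⟩ := not_or.1 h
    exact (dist1_gaugeAct_holAtGauge_le_of_shadow av reg M₁ Z hk 𝔅 h𝔅0 path hF2 W hmin hρ h𝒞 hGN hb hbs hbt).trans (le_max_left _ _)

/-- ★★★ **THE LOCALISED GAUGE LETTER (σ) AT THE ENDPOINT's OBJECTS — BOND-DATUM EDITION.**  Objects at one instance: averaging `Node00.avOfRecord F 2 Kt`, class
`regMSCoPOfRecord F 2 ν Kt k (maxDomT ν.M₁ Z)`, a bond determining set `𝔅` of height `k ≤ m + K` whose scale-`0` member contains the bonds with both end-points off `Ω₁(Z)` (`h𝔅0`; print's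
[II] (2.3) datum at `Z`'s maximal sequence), a base field's extended datum `Ṽ` which is `ρn`-near `1` on a set `𝒞` of `k`-bonds (`0 ≤ ρn`), a (2.12) minimiser `U₀` (`IsMinimizerB`); a rooted
forest `path` with (F2) at `𝔅`; a bond neighbourhood `N` whose block-crossing bonds with both end-points off `Ω₁(Z)` have their `k`-shadows in `𝒞` and which contains the four bonds of every
plaquette touching `Ω₁(Z)`; and the DISPLAYED interior letter [15] (16)–(18) for `U₀` in the gauge `Ax_k(𝔅_k, U₀)` with bound `Θ` on the bonds TOUCHING `Ω₁(Z)`.  THEN the tower-axial gauge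
`σ` carries: the root letter `hu` at all levels `≤ k` of `𝔅`; (C1) VERBATIM — the four bonds of every plaquette touching `Ω₁(Z)` are `max ρn Θ`-near `1`; and (Cin) on ALL of `N` with the
same tolerance. [cite: Balaban1985Variational, (4) p.278, (16)–(18) p.280; Balaban1985RegularSpaces, (1.19) p.79; Balaban1988Convergent, (2.2) p.255, (2.11)–(2.13) pp.256–257, (2.16) p.257;
Balaban1989LargeFieldI, (1.74) p.192, Prop. 1 p.194; Balaban1984PropagatorsII, (2.3) p.224] -/
theorem exists_gaugeLetterLoc_atRecord {F : T4Family} (ν : Node00.Stage7Numerics) (Kt : ℕ) {k : ℕ}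
    (hk : k ≤ (F.P Kt).m + (F.P Kt).K) (Z : Set (Site (F.P Kt) 0)) (𝔅 : BDetSet (F.P Kt))
    (h𝔅0 : ∀ b : PBond (F.P Kt) 0, b.src ∉ maxDomT ν.M₁ Z 1 → b.tgt ∉ maxDomT ν.M₁ Z 1 → b ∈ 𝔅 0)
    (path : Site (F.P Kt) 0 → List (LStep (F.P Kt) 0))
    (hF2 : ∀ j, j ≤ k → ∀ c ∈ 𝔅 j, path (embIter j c.src) = [] ∧ path (embIter j c.tgt) = [])
    {ρn Θ : ℝ} (hρn : 0 ≤ ρn)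
    (W : GaugeField (F.P Kt) k SU2) (𝒞 : Set (PBond (F.P Kt) k)) (hD : ∀ c ∈ 𝒞, dist1 (W c) ≤ ρn)
    {U₀ : GaugeField (F.P Kt) 0 SU2}
    (hmin : IsMinimizerB (Node00.avOfRecord F 2 Kt) (Node00.regMSCoPOfRecord F 2 ν Kt k (maxDomT ν.M₁ Z)) 𝔅
      (avgFamily (Node00.avOfRecord F 2 Kt) (qsstarGIter0 k W)) U₀)
    -- geometry of the neighbourhood `N`
    (N : Set (PBond (F.P Kt) 0))
    (hGN : ∀ b ∈ N, b.src ∉ maxDomT ν.M₁ Z 1 → b.tgt ∉ maxDomT ν.M₁ Z 1 → blockIter k b.tgt ≠ blockIter k b.src →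
      (⟨blockIter k b.src, b.dir⟩ : PBond (F.P Kt) k) ∈ 𝒞)
    (hN1 : ∀ p : Plaq (F.P Kt) 0, ((⟨p.src, p.μ⟩ : PBond (F.P Kt) 0) ∈ {b : PBond (F.P Kt) 0 | b.src ∈ maxDomT ν.M₁ Z 1} ∨
        (⟨p.src.shift p.μ, p.ν⟩ : PBond (F.P Kt) 0) ∈ {b : PBond (F.P Kt) 0 | b.src ∈ maxDomT ν.M₁ Z 1} ∨
        (⟨p.src.shift p.ν, p.μ⟩ : PBond (F.P Kt) 0) ∈ {b : PBond (F.P Kt) 0 | b.src ∈ maxDomT ν.M₁ Z 1} ∨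
        (⟨p.src, p.ν⟩ : PBond (F.P Kt) 0) ∈ {b : PBond (F.P Kt) 0 | b.src ∈ maxDomT ν.M₁ Z 1}) →
      (⟨p.src, p.μ⟩ : PBond (F.P Kt) 0) ∈ N ∧ (⟨p.src.shift p.μ, p.ν⟩ : PBond (F.P Kt) 0) ∈ N ∧
        (⟨p.src.shift p.ν, p.μ⟩ : PBond (F.P Kt) 0) ∈ N ∧ (⟨p.src, p.ν⟩ : PBond (F.P Kt) 0) ∈ N)
    -- DISPLAYED: the interior estimate [15] (16)–(18) in the tower-axial gauge, on the bonds TOUCHING `Ω₁(Z)` (crossing bonds included)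
    (hL : ∀ b : PBond (F.P Kt) 0, (b.src ∈ maxDomT ν.M₁ Z 1 ∨ b.tgt ∈ maxDomT ν.M₁ Z 1) →
      ‖((gaugeAct (fun x => holAt U₀ (path x)) U₀ b : SU2) : Matrix (Fin 2) (Fin 2) ℂ) - 1‖ ≤ Θ) :
    ∃ σ : GaugeTransf (F.P Kt) 0 SU2,
      (∀ j, j ≤ k → ∀ b ∈ 𝔅 j, toMS σ j b.src = 1 ∧ toMS σ j b.tgt = 1) ∧
        (∀ p : Plaq (F.P Kt) 0, ((⟨p.src, p.μ⟩ : PBond (F.P Kt) 0) ∈ {b : PBond (F.P Kt) 0 | b.src ∈ maxDomT ν.M₁ Z 1} ∨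
            (⟨p.src.shift p.μ, p.ν⟩ : PBond (F.P Kt) 0) ∈ {b : PBond (F.P Kt) 0 | b.src ∈ maxDomT ν.M₁ Z 1} ∨
            (⟨p.src.shift p.ν, p.μ⟩ : PBond (F.P Kt) 0) ∈ {b : PBond (F.P Kt) 0 | b.src ∈ maxDomT ν.M₁ Z 1} ∨
            (⟨p.src, p.ν⟩ : PBond (F.P Kt) 0) ∈ {b : PBond (F.P Kt) 0 | b.src ∈ maxDomT ν.M₁ Z 1}) →
          ‖((gaugeAct σ U₀ ⟨p.src, p.μ⟩ : SU2) : Matrix (Fin 2) (Fin 2) ℂ) - 1‖ ≤ max ρn Θ ∧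
            ‖((gaugeAct σ U₀ ⟨p.src.shift p.μ, p.ν⟩ : SU2) : Matrix (Fin 2) (Fin 2) ℂ) - 1‖ ≤ max ρn Θ ∧
            ‖((gaugeAct σ U₀ ⟨p.src.shift p.ν, p.μ⟩ : SU2) : Matrix (Fin 2) (Fin 2) ℂ) - 1‖ ≤ max ρn Θ ∧
            ‖((gaugeAct σ U₀ ⟨p.src, p.ν⟩ : SU2) : Matrix (Fin 2) (Fin 2) ℂ) - 1‖ ≤ max ρn Θ) ∧
        (∀ b ∈ N, ‖((gaugeAct σ U₀ b : SU2) : Matrix (Fin 2) (Fin 2) ℂ) - 1‖ ≤ max ρn Θ) := by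
  have key : ∀ b ∈ N, dist1 (gaugeAct (fun x => holAt U₀ (path x)) U₀ b) ≤ max ρn Θ := fun b hb =>
    dist1_gaugeAct_holAtGauge_le_of_mem_nbhd (Node00.avOfRecord F 2 Kt) _ ν.M₁ Z hk 𝔅 h𝔅0 path hF2 W hmin hρn hD hGN hL hb
  refine ⟨fun x => holAt U₀ (path x), toMS_holAtGauge_eq_one path U₀ 𝔅 k hF2, fun p hp => ?_, fun b hbN => key b hbN⟩
  obtain ⟨h₁, h₂, h₃, h₄⟩ := hN1 p hp
  exact ⟨key _ h₁, key _ h₂, key _ h₃, key _ h₄⟩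

end Loc

end Literature.MathematicalPhysics.QuantumFieldTheory.Balaban1983to89.B15Prop1GaugeLetterGammaZeroPinB

end
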